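import Summits.BirchSwinnertonDyer.BirchSwinnertonDyer.Theorems.BiquadraticEisensteinDescentHeegnerTwistCouplingInSupplyQuarticTwistCorner
import Summits.BirchSwinnertonDyer.BirchSwinnertonDyer.Theorems.BiquadraticEisensteinDescentHeegnerTwistCouplingInSupplyIndefinitePinWitness
import Mathlib.NumberTheory.Zsqrtd.Basic
import HarnessLib

set_option linter.dupNamespace false -- `Summit.BirchSwinnertonDyer.BirchSwinnertonDyer.Theorems.…` (summit = sub, D-0017)
set_option autoImplicit false

/-!
# Crux `HeegnerTwistCouplingInSupply` (stmt-BirchSwinnertonDyer-21381) — the SYLVESTER `j = 0` corner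
# `W_p : y² + p·y = x³`, `p ≡ 8 (mod 9)`: family, `3`-descent DOOR, and the crux conclusion at `(W_p, p)` from ONE
# kernel-checkable certificate `(D; a, b)` (card `splitting-bias`, cruxidea seat 1 g28)

Route `BiquadraticEisensteinDescent` (cell `pub/bsd-wall`, width seat `bsd-wall-cm-bed-w4` g26; `--supports` 21381, helper;
answers LEAD-VERDICT-ibd-p1-g11 §4 (iii) «`j ≠ 1728`: no descent criterion typed»). The `j = 0` member of the crux's habitat
is Sylvester's family `W_p = ⟨0, 0, p, 0, 0⟩ : y² + p·y = x³` (`Δ = −27p⁴`, CM by `ℤ[ζ₃]`; for a prime `p ≡ 2 (mod 3)` the prime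
`p` is inert in `ℚ(√−3)` and `W_p` is additive at `p`; for `p ≡ 8 (mod 9)` the root number is `−1` — the `3`-isogenous curve is
`x³ + y³ = p`). Its quadratic twist by `d` is `W_p^{(d)} = ⟨0, 0, 0, 0, d³p²/4⟩ ≅ y² = x³ + 16p²d³`, a Mordell curve with a
RATIONAL `3`-isogeny. The card `Ideas/splitting-bias.md` certifies `L(W_p^{(D)}, 1) ≠ 0` for a Heegner discriminant `D`
(`D ≡ 1 (mod 3)`, `(D/p) = +1`) by a `3`-ISOGENY DESCENT: `3 ∤ h(D)` kills the `φ`-Selmer group but for the conductor-`9`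
character, which is killed iff the unit `ε_{−3D}` of the real field `ℚ(√−3D)` is NOT a cube modulo the inert prime `p`; then
`Sel₃(W_p^{(D)}) = 0`, i.e. `rank = 0` and `Ш[3] = 0` (card-validated: kit j330880, 0/314 violations; this seat's j332101,
0/138). Since `p ≡ 2 (mod 3)`, a unit `u = (a + b√M)/2` (`M = −3D`, `a² − M b² = 4`) is a cube in `(𝓞/p)^× = 𝔽_{p²}^×`
iff `u^{(p+1)/3} ∈ 𝔽_p`, i.e. iff `p ∣ Im((a + b√M)^{(p+1)/3})` (`2` is a cube as `3 ∤ p − 1`): the LUCAS FORM of the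
certificate, decidable in the kernel on `ℤ√M` (Mathlib `Zsqrtd`).

* §1 the family: `W_p^{(d)}` literal, `j = 0`, `HasCM` of every twist, `Δ(ℤ-model) = −27p⁴`, good reduction away from `3p`,
  so every prime divisor of `N(W_p)` is `3` or `p` (no modularity used);
* §2 the DOOR at the prime `3` (any curve over `ℚ` with `j = 0`): `rank = 0 ∧ Ш[3] = 0 ⟹ corank_{ℤ₃} Sel_{3^∞} = 0` (tree:
  Greenberg's identity `selmerCorank_eq_mordellWeilRank_add_holds` + `shaCorank_eq_zero_of_forall`) `⟹ r_an = 0` (Burungale–Tian,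
  named fact `hBT`, any prime) `⟹ L(·,1) ≠ 0` (Deuring–Hecke continuation for `j = 0 ∈ maximalCMJInvariants`, named fact `hH`);
* §3 Heegner data for a level with prime support `{3, p}` from `(d_K/3) = (d_K/p) = +1` (no parity condition on `d_K`: the
  level is odd);
* §4 ★ `cruxConclusion_of_certificate`: for a prime `p ≡ 8 (mod 9)`, an imaginary quadratic `K` with `4 < |d_K|`,
  `(d_K/3) = (d_K/p) = +1`, `h_K < p`, `3 ∤ h_K`, and integers `a, b` with `a² + 3d_K b² = 4`, `p ∤ Im((a + b√(−3d_K))^{(p+1)/3})`: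
  MODULO the `3`-descent hypothesis `hDesc` (shape below, the card's L1 in Lucas form), `hBT` and `hH` — the CONCLUSION of
  crux 21381 at `(W_p, p)` with `K′ = K`: Heegner for `N(W_p)`, `L(W_p^{(d_K)}, 1) ≠ 0`, `h_K < p`, `p ∤ h_K`.
  The companion `…SylvesterCornerTable.lean` feeds it a kernel table (every prime `p ≡ 8 (mod 9)` below `10⁴`).

The `3`-descent hypothesis `hDesc` (NOT formalised here; Satgé 1986 / Cohen–Pazuki 2009 style `3`-isogeny descent on
`y² = x³ + k`, specialised by the card to `k = 16p²D³`; it is an INPUT of every theorem that uses it, never asserted):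
`∀ p K M a b, p ≡ 8 (mod 9) → K imaginary quadratic → 4 < |d_K| → (d_K/3) = 1 → (d_K/p) = 1 → 3 ∤ h_K → M = −3 d_K →
a² − M b² = 4 → p ∤ Im((a + b√M)^{(p+1)/3}) → rank W_p^{(d_K)}(ℚ) = 0 ∧ Ш(W_p^{(d_K)}/ℚ)[3] = 0`.

HONEST FRAMING: a typed sub-corner on ONE more CM family (measure zero in «all CM `W`»); conditional on `hDesc` (descent not
in the tree), `hBT`, `hH`; the crux (residual C⁺), its registered stubs and BSD are untouched; nothing is closed by this file.
THEOREMS ONLY (no `def`, no new named fact, no sorry). Supports stmt-BirchSwinnertonDyer-21381.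
[cite: SilvermanAEC2009, X.5 Prop. 5.4; VII.5 Prop. 5.1(a); App. C §11] [cite: BurungaleTian2026, Thm. 1.1]
[cite: SilvermanATAEC1994, Ch. II Cor. 10.5.1] [cite: Greenberg1999LNM, §1 pp. 54–57] [cite: CohenPazuki2009, §2]
[cite: GrossLMS1991, §1] [cite: Marcus2018, Ch. 3 Thm. 25]
-/

noncomputable section

open scoped Classical NumberField

namespace Summit.BirchSwinnertonDyer.BirchSwinnertonDyer.Theorems.SylvesterCorner

open _root_.WeierstrassCurve Literature.NumberTheory.EllipticCurves
open IsDedekindDomain Rat.HeightOneSpectrum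

/-! ## §1 The family `W_p : y² + p·y = x³` and its twists -/

section Family

/-- **Twisting the Sylvester family**: `(y² + py = x³)^{(d)} = (y² = x³ + d³p²/4)` (`b₂ = b₄ = 0`, `b₆ = p²`).
[cite: SilvermanAEC2009, X.5 Prop. 5.4] -/
theorem quadraticTwist_sylvester (p : ℕ) (d : ℚ) :
    (⟨0, 0, (p : ℚ), 0, 0⟩ : WeierstrassCurve ℚ).quadraticTwist d = ⟨0, 0, 0, 0, d ^ 3 * (p : ℚ) ^ 2 / 4⟩ := by
  ext
  · rfl
  · simp [WeierstrassCurve.quadraticTwist, WeierstrassCurve.b₂]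
  · rfl
  · simp [WeierstrassCurve.quadraticTwist, WeierstrassCurve.b₄]
  · simp only [WeierstrassCurve.quadraticTwist, WeierstrassCurve.b₆]
    ring

/-- `Δ(W_p) = −27p⁴` over `ℚ`. [cite: SilvermanAEC2009, III.1] -/
theorem Δ_sylvester (p : ℕ) : (⟨0, 0, (p : ℚ), 0, 0⟩ : WeierstrassCurve ℚ).Δ = -27 * (p : ℚ) ^ 4 := by
  simp only [WeierstrassCurve.Δ, WeierstrassCurve.b₂, WeierstrassCurve.b₄, WeierstrassCurve.b₆, WeierstrassCurve.b₈]
  ring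

/-- **`W_p` is an elliptic curve** for `p ≠ 0` (`Δ = −27p⁴ ≠ 0`). [cite: SilvermanAEC2009, III.1] -/
theorem isElliptic_sylvester {p : ℕ} (hp : p ≠ 0) : (⟨0, 0, (p : ℚ), 0, 0⟩ : WeierstrassCurve ℚ).IsElliptic := by
  refine ⟨?_⟩
  rw [isUnit_iff_ne_zero, Δ_sylvester]
  exact mul_ne_zero (by norm_num) (pow_ne_zero _ (by exact_mod_cast hp))

/-- `c₄(W_p) = 0`, hence **`j(W_p) = 0`**. [cite: SilvermanAEC2009, III.1 and App. C §11] -/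
theorem j_sylvester (p : ℕ) [(⟨0, 0, (p : ℚ), 0, 0⟩ : WeierstrassCurve ℚ).IsElliptic] :
    (⟨0, 0, (p : ℚ), 0, 0⟩ : WeierstrassCurve ℚ).j = 0 :=
  j_eq_zero _ (by simp [WeierstrassCurve.c₄, WeierstrassCurve.b₂, WeierstrassCurve.b₄])

/-- **Every quadratic twist `W_p^{(d)}` (`d ≠ 0`, `p ≠ 0`) is an elliptic curve with `j = 0` and CM.**
[cite: SilvermanAEC2009, X.5 Prop. 5.4 and App. C §11 (C.11.3.1)] -/
theorem isElliptic_j_hasCM_twist {p : ℕ} (hp : p ≠ 0) {d : ℚ} (hd : d ≠ 0) :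
    ∃ _ : ((⟨0, 0, (p : ℚ), 0, 0⟩ : WeierstrassCurve ℚ).quadraticTwist d).IsElliptic,
      ((⟨0, 0, (p : ℚ), 0, 0⟩ : WeierstrassCurve ℚ).quadraticTwist d).j = 0 ∧
        ((⟨0, 0, (p : ℚ), 0, 0⟩ : WeierstrassCurve ℚ).quadraticTwist d).HasCM := by
  haveI := isElliptic_sylvester hp
  haveI := (⟨0, 0, (p : ℚ), 0, 0⟩ : WeierstrassCurve ℚ).isElliptic_quadraticTwist hd
  have hj : ((⟨0, 0, (p : ℚ), 0, 0⟩ : WeierstrassCurve ℚ).quadraticTwist d).j = 0 := by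
    rw [(⟨0, 0, (p : ℚ), 0, 0⟩ : WeierstrassCurve ℚ).j_quadraticTwist hd, j_sylvester]
  exact ⟨inferInstance, hj, WeierstrassCurve.hasCM_of_j_eq_zero _ hj⟩

/-- The `ℤ`-model `⟨0, 0, p, 0, 0⟩` maps to `W_p`. [folklore] -/
theorem map_WInt (p : ℕ) :
    (⟨0, 0, (p : ℤ), 0, 0⟩ : WeierstrassCurve ℤ).map (Int.castRingHom ℚ) = ⟨0, 0, (p : ℚ), 0, 0⟩ := by
  ext <;> simp [WeierstrassCurve.map]

/-- `Δ(⟨0, 0, p, 0, 0⟩ / ℤ) = −27p⁴`. [cite: SilvermanAEC2009, III.1] -/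
theorem WInt_Δ (p : ℕ) : (⟨0, 0, (p : ℤ), 0, 0⟩ : WeierstrassCurve ℤ).Δ = -27 * (p : ℤ) ^ 4 := by
  simp only [WeierstrassCurve.Δ, WeierstrassCurve.b₂, WeierstrassCurve.b₄, WeierstrassCurve.b₆, WeierstrassCurve.b₈]
  ring

/-- A prime `r ∤ 3p` does not divide `Δ = −27p⁴`. [folklore] -/
theorem not_dvd_WInt_Δ {p r : ℕ} (hr : r.Prime) (hrp : ¬ r ∣ 3 * p) :
    ¬ (r : ℤ) ∣ (⟨0, 0, (p : ℤ), 0, 0⟩ : WeierstrassCurve ℤ).Δ := by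
  rw [WInt_Δ]
  intro h
  have h' : (r : ℤ) ∣ 27 * (p : ℤ) ^ 4 := by
    have : (-27 : ℤ) * (p : ℤ) ^ 4 = -(27 * (p : ℤ) ^ 4) := by ring
    rw [this] at h
    exact (dvd_neg).mp h
  have h'' : r ∣ 27 * p ^ 4 := by exact_mod_cast h'
  rcases (Nat.Prime.dvd_mul hr).mp h'' with h27 | hp4
  · exact hrp ((hr.dvd_of_dvd_pow (show r ∣ 3 ^ 3 by simpa using h27)).mul_right p)
  · exact hrp ((hr.dvd_of_dvd_pow hp4).mul_left 3)

/-- **`W_p` has good reduction at every prime `r ∤ 3p`** (`r ∤ Δ` of the `ℤ`-model; Silverman VII.5.1(a), prime-indexed form).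
[cite: SilvermanAEC2009, VII.5 Prop. 5.1(a)] -/
theorem hasGoodReductionAtPrime_W {p r : ℕ} [Fact r.Prime] (hrp : ¬ r ∣ 3 * p) :
    (⟨0, 0, (p : ℚ), 0, 0⟩ : WeierstrassCurve ℚ).HasGoodReductionAtPrime r := by
  obtain ⟨v, rfl⟩ : ∃ v : HeightOneSpectrum (𝓞 ℚ), (primesEquiv v : ℕ) = r :=
    ⟨primesEquiv.symm ⟨r, Fact.out⟩, by rw [Equiv.apply_symm_apply]⟩
  rw [← map_WInt]
  exact (hasGoodReductionAtPrime_iff_hasGoodReductionAt_ringOfIntegers v _).2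
    (hasGoodReductionAt_map_of_not_dvd _ v (not_dvd_WInt_Δ Fact.out hrp))

/-- **Every prime divisor of `N(W_p)` is `3` or `p`** (no modularity: `not_dvd_conductorNorm_of_hasGoodReductionAtPrime`).
[cite: SilvermanATAEC1994, Thm. IV.10.2(a)] -/
theorem eq_three_or_eq_of_prime_dvd_conductorNorm_W {p r : ℕ} [(⟨0, 0, (p : ℚ), 0, 0⟩ : WeierstrassCurve ℚ).IsElliptic]
    (hp : p.Prime) (hr : r.Prime) (h : r ∣ (⟨0, 0, (p : ℚ), 0, 0⟩ : WeierstrassCurve ℚ).conductorNorm ℤ) :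
    r = 3 ∨ r = p := by
  by_contra hne
  push Not at hne
  have hrp : ¬ r ∣ 3 * p := fun hd => by
    rcases (Nat.Prime.dvd_mul hr).mp hd with h3 | hp'
    · exact hne.1 ((Nat.prime_dvd_prime_iff_eq hr Nat.prime_three).mp h3)
    · exact hne.2 ((Nat.prime_dvd_prime_iff_eq hr hp).mp hp')
  haveI : Fact r.Prime := ⟨hr⟩
  exact not_dvd_conductorNorm_of_hasGoodReductionAtPrime _ (hasGoodReductionAtPrime_W hrp) h

end Family

/-! ## §2 The door at the prime `3`: `rank = 0 ∧ Ш[3] = 0 ⟹ corank₃ Sel = 0 ⟹ L(·, 1) ≠ 0` for `j = 0` -/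

section Door

/-- **`rank E(ℚ) = 0` and `Ш(E/ℚ)[3] = 0` give `corank_{ℤ₃} Sel_{3^∞}(E/ℚ) = 0`** (Greenberg's identity
`corank Sel = rank + corank Ш`, tree theorem, and `Ш[3] = 0 ⟹ Ш[3^∞] = 0 ⟹ corank 0`). [cite: Greenberg1999LNM, §1 pp. 54–57] -/
theorem selmerCorank_three_eq_zero (E : WeierstrassCurve ℚ) [E.IsElliptic] (hrank : E.mordellWeilRank = 0)
    (hsha : ∀ c ∈ E.sha, 3 • c = 0 → c = 0) : E.selmerCorank 3 = 0 := by
  haveI : Fact (Nat.Prime 3) := ⟨Nat.prime_three⟩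
  rw [E.selmerCorank_eq_mordellWeilRank_add_holds 3, hrank, E.shaCorank_eq_zero_of_forall 3 hsha]

/-- **The door.** For an elliptic curve `E/ℚ` with `j(E) = 0`: `rank = 0 ∧ Ш[3] = 0 ⟹ r_an(E) = 0 ∧ L(E, 1) ≠ 0`, modulo
Burungale–Tian (`hBT`, corank-`0` converse for CM curves, here at the prime `3`; `j = 0` curves have CM) and Deuring–Hecke (`hH`,
`0 ∈ maximalCMJInvariants`, so `L(E, s)` is entire and `r_an = 0` reads `L(E, 1) ≠ 0`).
[cite: BurungaleTian2026, Thm. 1.1] [cite: SilvermanATAEC1994, Ch. II Cor. 10.5.1] [cite: SilvermanAEC2009, App. C §11 (C.11.3.1)] -/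
theorem L_one_ne_zero_of_desc (hBT : burungaleTian_analyticRank_eq_zero_of_selmerCorank_eq_zero_of_hasCM)
    (hH : hasEntireLFunction_of_j_mem_maximalCMJInvariants) (E : WeierstrassCurve ℚ) [E.IsElliptic] (hj : E.j = 0)
    (hrank : E.mordellWeilRank = 0) (hsha : ∀ c ∈ E.sha, 3 • c = 0 → c = 0) :
    E.analyticRank = 0 ∧ E.entireLFunction 1 ≠ 0 := by
  haveI : Fact (Nat.Prime 3) := ⟨Nat.prime_three⟩
  have hCM : E.HasCM := WeierstrassCurve.hasCM_of_j_eq_zero _ hj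
  have h0 := hBT _ hCM 3 (selmerCorank_three_eq_zero E hrank hsha)
  refine ⟨h0, (analyticRank_eq_zero_iff_holds (W := E) (hH _ ?_)).1 h0⟩
  rw [hj]
  simp [maximalCMJInvariants]

end Door

/-! ## §3 Heegner data for a level with prime support `{3, p}` -/

section Heegner

/-- **The Heegner hypothesis for a level `N` whose prime divisors are `3` or `p` (`p` odd)** in a quadratic field `K`, from
`(d_K/3) = (d_K/p) = +1` (Kronecker criterion `satisfiesHeegnerHypothesis_iff_kronecker`; the clause at `2` is vacuous since
`N` is odd). [cite: GrossLMS1991, §1] [cite: Marcus2018, Ch. 3 Thm. 25] -/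
theorem satisfiesHeegnerHypothesis_of_three_p {K : Type} [Field K] [NumberField K] (h2 : Module.finrank ℚ K = 2)
    {p : ℕ} (hp2 : p ≠ 2) (hJ3 : jacobiSym (NumberField.discr K) 3 = 1) (hJp : jacobiSym (NumberField.discr K) p = 1)
    {N : ℕ} (hN : ∀ r : ℕ, r.Prime → r ∣ N → r = 3 ∨ r = p) :
    SatisfiesHeegnerHypothesis N K := by
  rw [satisfiesHeegnerHypothesis_iff_kronecker N K h2]
  intro r hr hrN
  rcases hN r hr hrN with rfl | rfl
  · exact ⟨fun h => absurd h (by norm_num), fun _ => hJ3⟩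
  · exact ⟨fun h => absurd h hp2, fun _ => hJp⟩

end Heegner

/-! ## §4 ★ The crux conclusion at `(W_p, p)` from ONE certificate `(K; a, b)`, modulo `hDesc`, `hBT`, `hH` -/

section Corner

/-- ★ **The Sylvester corner from a certificate.** For a prime `p ≡ 8 (mod 9)`, an imaginary quadratic field `K` with
`4 < |d_K|`, `(d_K/3) = (d_K/p) = +1` (so `K` is Heegner for `N(W_p)`, prime support `{3, p}`), `h_K < p`, `3 ∤ h_K`, and a
Lucas certificate `(a, b)`: `a² + 3 d_K b² = 4` (i.e. `(a + b√(−3d_K))/2` is a norm-one unit of `ℚ(√−3d_K)`) with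
`p ∤ Im((a + b√(−3d_K))^{(p+1)/3})` (the unit is not a cube modulo the inert prime `p`) — MODULO the `3`-descent hypothesis
`hDesc` (card `splitting-bias` L1 in Lucas form: these data give `rank W_p^{(d_K)}(ℚ) = 0` and `Ш(W_p^{(d_K)}/ℚ)[3] = 0`),
Burungale–Tian (`hBT`) and Deuring–Hecke (`hH`): the CONCLUSION of crux 21381 at `(W_p, p)` with `K′ = K` —
`K` imaginary quadratic, `4 < |d_K|`, Heegner for `N(W_p)`, `L(W_p^{(d_K)}, 1) ≠ 0`, `h_K < p`, `p ∤ h_K`.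
[cite: CohenPazuki2009, §2] [cite: BurungaleTian2026, Thm. 1.1] [cite: SilvermanATAEC1994, Ch. II Cor. 10.5.1]
[cite: GrossLMS1991, §1] -/
theorem cruxConclusion_of_certificate
    (hDesc : ∀ (p : ℕ) (K : Type) [Field K] [NumberField K] (M a b : ℤ), p.Prime → p % 9 = 8 →
      IsImaginaryQuadratic K → 4 < (NumberField.discr K).natAbs →
      jacobiSym (NumberField.discr K) 3 = 1 → jacobiSym (NumberField.discr K) p = 1 →
      ¬ 3 ∣ NumberField.classNumber K → M = -3 * NumberField.discr K → a ^ 2 - M * b ^ 2 = 4 →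
      ¬ (p : ℤ) ∣ ((⟨a, b⟩ : ℤ√M) ^ ((p + 1) / 3)).im →
      ((⟨0, 0, (p : ℚ), 0, 0⟩ : WeierstrassCurve ℚ).quadraticTwist (NumberField.discr K : ℚ)).mordellWeilRank = 0 ∧
      ∀ c ∈ ((⟨0, 0, (p : ℚ), 0, 0⟩ : WeierstrassCurve ℚ).quadraticTwist (NumberField.discr K : ℚ)).sha,
        3 • c = 0 → c = 0)
    (hBT : burungaleTian_analyticRank_eq_zero_of_selmerCorank_eq_zero_of_hasCM)
    (hH : hasEntireLFunction_of_j_mem_maximalCMJInvariants)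
    {p : ℕ} (hp : p.Prime) (hp9 : p % 9 = 8) [(⟨0, 0, (p : ℚ), 0, 0⟩ : WeierstrassCurve ℚ).IsElliptic]
    (K : Type) [Field K] [NumberField K] (hK : IsImaginaryQuadratic K) (hd4 : 4 < (NumberField.discr K).natAbs)
    (hJ3 : jacobiSym (NumberField.discr K) 3 = 1) (hJp : jacobiSym (NumberField.discr K) p = 1)
    (hh : NumberField.classNumber K < p) (hh3 : ¬ 3 ∣ NumberField.classNumber K)
    {M a b : ℤ} (hM : M = -3 * NumberField.discr K) (hab : a ^ 2 - M * b ^ 2 = 4)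
    (hL : ¬ (p : ℤ) ∣ ((⟨a, b⟩ : ℤ√M) ^ ((p + 1) / 3)).im) :
    IsImaginaryQuadratic K ∧ 4 < (NumberField.discr K).natAbs ∧
      SatisfiesHeegnerHypothesis ((⟨0, 0, (p : ℚ), 0, 0⟩ : WeierstrassCurve ℚ).conductorNorm ℤ) K ∧
      ((⟨0, 0, (p : ℚ), 0, 0⟩ : WeierstrassCurve ℚ).quadraticTwist (NumberField.discr K : ℚ)).entireLFunction 1 ≠ 0 ∧
      NumberField.classNumber K < p ∧ ¬ p ∣ NumberField.classNumber K := by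
  have hp2 : p ≠ 2 := by rintro rfl; omega
  have hp0 : p ≠ 0 := hp.ne_zero
  -- Heegner for `N(W_p)`: prime support `{3, p}`
  have hHeeg : SatisfiesHeegnerHypothesis ((⟨0, 0, (p : ℚ), 0, 0⟩ : WeierstrassCurve ℚ).conductorNorm ℤ) K :=
    satisfiesHeegnerHypothesis_of_three_p hK.1 hp2 hJ3 hJp
      (fun r hr hrN => eq_three_or_eq_of_prime_dvd_conductorNorm_W hp hr hrN)
  -- the twist is elliptic with `j = 0`
  have hd0 : (NumberField.discr K : ℚ) ≠ 0 := by
    have : NumberField.discr K ≠ 0 := by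
      intro h
      rw [h] at hd4
      simp at hd4
    exact_mod_cast this
  obtain ⟨hE, hj, -⟩ := isElliptic_j_hasCM_twist hp0 hd0
  obtain ⟨hrank, hsha⟩ := hDesc p K M a b hp hp9 hK hd4 hJ3 hJp hh3 hM hab hL
  have hL1 := (L_one_ne_zero_of_desc hBT hH _ hj hrank hsha).2
  exact ⟨hK, hd4, hHeeg, hL1, hh, fun hdvd => absurd (Nat.le_of_dvd (NumberField.classNumber_pos (K := K)) hdvd)
    (not_le.mpr hh)⟩

/-- ★ **The same, packaged as the crux's `∃ K′` conclusion at `(W_p, p)`.** [cite: CohenPazuki2009, §2]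
[cite: BurungaleTian2026, Thm. 1.1] [cite: SilvermanATAEC1994, Ch. II Cor. 10.5.1] [cite: GrossLMS1991, §1] -/
theorem exists_cruxConclusion_of_certificate
    (hDesc : ∀ (p : ℕ) (K : Type) [Field K] [NumberField K] (M a b : ℤ), p.Prime → p % 9 = 8 →
      IsImaginaryQuadratic K → 4 < (NumberField.discr K).natAbs →
      jacobiSym (NumberField.discr K) 3 = 1 → jacobiSym (NumberField.discr K) p = 1 →
      ¬ 3 ∣ NumberField.classNumber K → M = -3 * NumberField.discr K → a ^ 2 - M * b ^ 2 = 4 →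
      ¬ (p : ℤ) ∣ ((⟨a, b⟩ : ℤ√M) ^ ((p + 1) / 3)).im →
      ((⟨0, 0, (p : ℚ), 0, 0⟩ : WeierstrassCurve ℚ).quadraticTwist (NumberField.discr K : ℚ)).mordellWeilRank = 0 ∧
      ∀ c ∈ ((⟨0, 0, (p : ℚ), 0, 0⟩ : WeierstrassCurve ℚ).quadraticTwist (NumberField.discr K : ℚ)).sha,
        3 • c = 0 → c = 0)
    (hBT : burungaleTian_analyticRank_eq_zero_of_selmerCorank_eq_zero_of_hasCM)
    (hH : hasEntireLFunction_of_j_mem_maximalCMJInvariants)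
    {p : ℕ} (hp : p.Prime) (hp9 : p % 9 = 8) [(⟨0, 0, (p : ℚ), 0, 0⟩ : WeierstrassCurve ℚ).IsElliptic]
    {D : ℤ} {h : ℕ} (hKex : ∃ (K : Type) (_ : Field K) (_ : NumberField K),
      IsImaginaryQuadratic K ∧ NumberField.discr K = D ∧ NumberField.classNumber K = h)
    (hD4 : 4 < D.natAbs) (hJ3 : jacobiSym D 3 = 1) (hJp : jacobiSym D p = 1) (hh : h < p) (hh3 : ¬ 3 ∣ h)
    {M a b : ℤ} (hM : M = -3 * D) (hab : a ^ 2 - M * b ^ 2 = 4)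
    (hL : ¬ (p : ℤ) ∣ ((⟨a, b⟩ : ℤ√M) ^ ((p + 1) / 3)).im) :
    ∃ (K : Type) (_ : Field K) (_ : NumberField K),
      IsImaginaryQuadratic K ∧ 4 < (NumberField.discr K).natAbs ∧
      SatisfiesHeegnerHypothesis ((⟨0, 0, (p : ℚ), 0, 0⟩ : WeierstrassCurve ℚ).conductorNorm ℤ) K ∧
      ((⟨0, 0, (p : ℚ), 0, 0⟩ : WeierstrassCurve ℚ).quadraticTwist (NumberField.discr K : ℚ)).entireLFunction 1 ≠ 0 ∧
      NumberField.classNumber K < p ∧ ¬ p ∣ NumberField.classNumber K := by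
  obtain ⟨K, iF, iN, hK, hdK, hhK⟩ := hKex
  refine ⟨K, iF, iN, ?_⟩
  subst hdK hhK
  exact cruxConclusion_of_certificate hDesc hBT hH hp hp9 K hK hD4 hJ3 hJp hh hh3 hM hab hL

end Corner

end Summit.BirchSwinnertonDyer.BirchSwinnertonDyer.Theorems.SylvesterCorner
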